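import Literature.AlgebraicGeometry.Frobenioids.EquivalenceFrobeniusDegrees
import Literature.AlgebraicGeometry.Frobenioids.EquivalenceLinearMorphisms
import Literature.AlgebraicGeometry.Frobenioids.EquivalencePreStepsQuasiIsotropic
import Mathlib.CategoryTheory.ObjectProperty.Equivalence
import Literature.AlgebraicGeometry.Frobenioids.EquivalenceUnitsTransport
import HarnessLib

/-!
# Frobenioids I, §3: Theorem 3.4 (iii) for Frobenioids of quasi-isotropic type over bases of FSM-type —
# Frobenius degrees, linear morphisms, Frobenius type, base-isomorphisms, pull-backs, isometries

Mochizuki, *The geometry of Frobenioids I: the general theory*, Kyushu J. Math. **62** (2008),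
Thm. 3.4 (iii), proof, kurims p. 64: "Since the isotropification functor preserves Frobenius degrees,
this implies that `Ψ` maps morphisms of Frobenius degree `d` to morphisms of Frobenius degree
`Ψ^{ℕ≥1}(d)`, hence that `Ψ` preserves linear morphisms and morphisms of Frobenius type [by Proposition
1.7, (iii)]. Moreover, by assertions (i), (ii), `Ψ` preserves isometric pre-steps and pre-steps, hence
base-isomorphisms …, pull-back morphisms [cf. Proposition 1.7, (ii)], isometries …"
[cite: MochizukiFrdI2008, Thm. 3.4 (iii) p.64].

PROOF-ONLY (seat abc-iut-L1-t13; the cell's repair programme, FSMFF strengthened to FSM-type).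
Standing hypotheses: `C₁`, `C₂` Frobenioids of quasi-isotropic type over bases of FSM-type, `Φ₁`, `Φ₂`
non-dilating, non-group-like objects on both sides, `Ψ : C₁ ≌ C₂`. First, in the isotropic case, `Ψ`
preserves the Frobenius degree of EVERY morphism (`FrdI.degFr_map_of_isotropic`: (F3) + Def. 1.3
(iv)(a)); then through `Ψ^istr` (Thm. 3.4 (i), Prop. 1.9 (v)) and isotropic hulls the same for
quasi-isotropic type (`FrdI.degFr_map`), whence linear morphisms, Frobenius type (Prop. 1.7 (iii):
minimal-coadjoint to the linear morphisms), base-isomorphisms (Prop. 1.7 (ii)), pull-back morphisms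
(Prop. 1.7 (ii)) and isometries are preserved. No statement of the paper is restated or strengthened.
-/

set_option backward.isDefEq.respectTransparency false

namespace Literature.AlgebraicGeometry.Frobenioids

open CategoryTheory Opposite

universe w v v' u u'

namespace FrdI

section Two

variable {D₁ : Type u} [Category.{v} D₁] {Φ₁ : D₁ᵒᵖ ⥤ CommMonCat.{w}} {C₁ : Type u'}
  [Category.{v'} C₁] {D₂ : Type u} [Category.{v} D₂] {Φ₂ : D₂ᵒᵖ ⥤ CommMonCat.{w}} {C₂ : Type u'}
  [Category.{v'} C₂] {F₁ : C₁ ⥤ ElemFrobenioid Φ₁} {F₂ : C₂ ⥤ ElemFrobenioid Φ₂}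

/-! ### Isotropic type: `Ψ` preserves all Frobenius degrees -/

/-- Isotropic type: `Ψ` preserves the Frobenius degree of morphisms of Frobenius type ((F3) on the
prime-Frobenius factors, Prop. 1.10 (v)). [cite: MochizukiFrdI2008, Thm. 3.4 (iii) p.64] -/
theorem degFr_map_of_isFrobeniusType (hF₁ : PreFrobenioid.IsFrobenioid F₁)
    (hF₂ : PreFrobenioid.IsFrobenioid F₂) (hi₁ : ∀ A : C₁, PreFrobenioid.IsIsotropic F₁ A)
    (hi₂ : ∀ A : C₂, PreFrobenioid.IsIsotropic F₂ A) (hD₁ : IsOfFSMType D₁) (hD₂ : IsOfFSMType D₂)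
    (hnd₁ : IsNonDilatingOn Φ₁) (hnd₂ : IsNonDilatingOn Φ₂) (Ψ : C₁ ≌ C₂) {N₁ : C₁}
    (hN₁ : ¬ PreFrobenioid.IsGroupLikeObj F₁ N₁) {N₂ : C₂} (hN₂ : ¬ PreFrobenioid.IsGroupLikeObj F₂ N₂) :
    ∀ (n : ℕ) {A A' : C₁} {f : A ⟶ A'}, PreFrobenioid.IsFrobeniusType F₁ f →
      (PreFrobenioid.degFr F₁ f : ℕ) = n → (PreFrobenioid.degFr F₂ (Ψ.functor.map f) : ℕ) = n := by
  intro n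
  induction n using Nat.strong_induction_on with
  | _ n ih =>
    intro A A' f hf hn
    by_cases h1 : PreFrobenioid.degFr F₁ f = 1
    · haveI := PreFrobenioid.isIso_of_isFrobeniusType_of_degFr_eq_one hF₁ hf h1
      rw [← hn, h1, show PreFrobenioid.degFr F₂ (Ψ.functor.map f) = 1 from
        PreFrobenioid.isLinear_of_isIso F₂ _]
    · have hn1 : n ≠ 1 := fun h => h1 (PNat.eq (by rw [PNat.one_coe, ← h, hn]))
      have hp : (Nat.minFac n).Prime := Nat.minFac_prime hn1
      obtain ⟨k, hk⟩ := Nat.minFac_dvd n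
      have hnpos : 0 < n := by rw [← hn]; exact PNat.pos _
      have hkpos : 0 < k := Nat.pos_of_ne_zero fun h0 => by
        rw [h0, mul_zero] at hk; exact hnpos.ne' hk
      obtain ⟨X, μ, ν, hμν, hμ, hμd, hν, hνd⟩ := PreFrobenioid.exists_split_of_isFrobeniusType hF₁ hf
        ⟨Nat.minFac n, Nat.minFac_pos n⟩ ⟨k, hkpos⟩ (PNat.eq (by rw [PNat.mul_coe, hn]; exact hk))
      have hμp : PreFrobenioid.IsPrimeFrobenius F₁ μ := ⟨hμ, by rw [hμd]; exact hp⟩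
      have hklt : k < n := by
        rw [hk]
        exact lt_mul_left hkpos hp.one_lt
      rw [← hμν, Functor.map_comp, PreFrobenioid.degFr_comp, PNat.mul_coe,
        degFr_map_of_isPrimeFrobenius hF₁ hF₂ hi₁ hi₂ hD₁ hD₂ hnd₁ hnd₂ Ψ hN₁ hN₂ (Nat.minFac n) hμp
          (by rw [hμd]; rfl), ih k hklt hν (by rw [hνd]; rfl)]
      exact hk.symm

/-- **Isotropic type: `Ψ` preserves the Frobenius degree of every morphism** (factor
`φ = α ∘ β ∘ γ`, Def. 1.3 (iv)(a): the pre-step and pull-back parts stay linear).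
[cite: MochizukiFrdI2008, Thm. 3.4 (iii) p.64] -/
theorem degFr_map_of_isotropic (hF₁ : PreFrobenioid.IsFrobenioid F₁)
    (hF₂ : PreFrobenioid.IsFrobenioid F₂) (hi₁ : ∀ A : C₁, PreFrobenioid.IsIsotropic F₁ A)
    (hi₂ : ∀ A : C₂, PreFrobenioid.IsIsotropic F₂ A) (hD₁ : IsOfFSMType D₁) (hD₂ : IsOfFSMType D₂)
    (hnd₁ : IsNonDilatingOn Φ₁) (hnd₂ : IsNonDilatingOn Φ₂) (Ψ : C₁ ≌ C₂) {N₁ : C₁}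
    (hN₁ : ¬ PreFrobenioid.IsGroupLikeObj F₁ N₁) {N₂ : C₂} (hN₂ : ¬ PreFrobenioid.IsGroupLikeObj F₂ N₂)
    {A B : C₁} (φ : A ⟶ B) :
    PreFrobenioid.degFr F₂ (Ψ.functor.map φ) = PreFrobenioid.degFr F₁ φ := by
  obtain ⟨X, Y, γ, β, α, hfac, hγ, hβ, hα⟩ := hF₁.iv_a_exists φ
  have hΨβ := isPreStep_map_of_isOfFSMType hF₁ hF₂ hi₁ hi₂ hD₂ Ψ hβ
  have hΨα := isPullbackMorphism_map hF₁ hF₂ hi₁ hi₂ hD₁ hD₂ hnd₁ Ψ hN₂ hα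
  apply PNat.eq
  rw [← hfac, Functor.map_comp, Functor.map_comp, PreFrobenioid.degFr_comp, PreFrobenioid.degFr_comp,
    PreFrobenioid.degFr_comp, PreFrobenioid.degFr_comp, show PreFrobenioid.degFr F₂ (Ψ.functor.map β) = 1
    from hΨβ.1, show PreFrobenioid.degFr F₂ (Ψ.functor.map α) = 1 from (hF₂.iv_b _ hΨα).2,
    show PreFrobenioid.degFr F₁ β = 1 from hβ.1, show PreFrobenioid.degFr F₁ α = 1 from (hF₁.iv_b _ hα).2]
  simp only [mul_one]
  exact degFr_map_of_isFrobeniusType hF₁ hF₂ hi₁ hi₂ hD₁ hD₂ hnd₁ hnd₂ Ψ hN₁ hN₂ _ hγ rfl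

/-! ### Quasi-isotropic type: through `Ψ^istr` and isotropic hulls -/

/-- The isotropic objects of `C₂` pulled back along `Ψ` are the isotropic objects of `C₁` (Thm. 3.4 (i)).
[cite: MochizukiFrdI2008, Thm. 3.4 (i) p.62] -/
theorem isotropicObjects_inverseImage (hF₁ : PreFrobenioid.IsFrobenioid F₁)
    (hq₁ : (PreFrobenioidData.ofFunctor Φ₁ F₁).IsOfQuasiIsotropicType)
    (hq₂ : (PreFrobenioidData.ofFunctor Φ₂ F₂).IsOfQuasiIsotropicType) (Ψ : C₁ ≌ C₂) :
    (PreFrobenioid.isotropicObjects F₂).inverseImage Ψ.functor = PreFrobenioid.isotropicObjects F₁ := by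
  funext X
  apply propext
  constructor
  · intro hX
    exact PreFrobenioid.IsIsotropic.of_iso hF₁.isPreFrobenioid (Ψ.unitIso.app X)
      (isIsotropic_map hq₂ hq₁ Ψ.symm hX)
  · intro hX
    exact isIsotropic_map hq₁ hq₂ Ψ hX

/-- A Frobenioid of quasi-isotropic type with a non-group-like object has a non-group-like ISOTROPIC object
(an isotropic hull, Def. 1.3 (vii)(a), is a base-isomorphism). [cite: MochizukiFrdI2008, Def. 1.3 (vii) p.31] -/
theorem exists_isotropic_not_isGroupLikeObj (hF₁ : PreFrobenioid.IsFrobenioid F₁) {N : C₁}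
    (hN : ¬ PreFrobenioid.IsGroupLikeObj F₁ N) :
    ∃ N' : C₁, PreFrobenioid.IsIsotropic F₁ N' ∧ ¬ PreFrobenioid.IsGroupLikeObj F₁ N' := by
  obtain ⟨N', h, hh⟩ := hF₁.vii_a N
  obtain ⟨-, hp, hN'i, -⟩ := id hh
  exact ⟨N', hN'i, fun h' => hN (isGroupLikeObj_of_isBaseIso' hF₁.isPreFrobenioid h hp.2 h')⟩

/-- **Thm. 3.4 (iii): `Ψ` preserves the Frobenius degree of every morphism** — quasi-isotropic type,
bases of FSM-type, `Φ₁`, `Φ₂` non-dilating, non-group-like objects on both sides ("since the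
isotropification functor preserves Frobenius degrees", through `Ψ^istr` and isotropic hulls).
[cite: MochizukiFrdI2008, Thm. 3.4 (iii) p.64] -/
theorem degFr_map (hF₁ : PreFrobenioid.IsFrobenioid F₁) (hF₂ : PreFrobenioid.IsFrobenioid F₂)
    (hq₁ : (PreFrobenioidData.ofFunctor Φ₁ F₁).IsOfQuasiIsotropicType)
    (hq₂ : (PreFrobenioidData.ofFunctor Φ₂ F₂).IsOfQuasiIsotropicType) (hD₁ : IsOfFSMType D₁)
    (hD₂ : IsOfFSMType D₂) (hnd₁ : IsNonDilatingOn Φ₁) (hnd₂ : IsNonDilatingOn Φ₂) (Ψ : C₁ ≌ C₂)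
    {N₁ : C₁} (hN₁ : ¬ PreFrobenioid.IsGroupLikeObj F₁ N₁) {N₂ : C₂}
    (hN₂ : ¬ PreFrobenioid.IsGroupLikeObj F₂ N₂) {A B : C₁} (φ : A ⟶ B) :
    PreFrobenioid.degFr F₂ (Ψ.functor.map φ) = PreFrobenioid.degFr F₁ φ := by
  have hP₁ := hF₁.isPreFrobenioid
  have hP₂ := hF₂.isPreFrobenioid
  -- `Ψ^istr`
  haveI : (PreFrobenioid.isotropicObjects F₂).IsClosedUnderIsomorphisms :=
    ⟨fun e hX => PreFrobenioid.IsIsotropic.of_iso hP₂ e.symm hX⟩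
  let Ψi : PreFrobenioid.Istr F₁ ≌ PreFrobenioid.Istr F₂ :=
    Ψ.congrFullSubcategory (isotropicObjects_inverseImage hF₁ hq₁ hq₂ Ψ)
  obtain ⟨M₁, hM₁i, hM₁⟩ := exists_isotropic_not_isGroupLikeObj hF₁ hN₁
  obtain ⟨M₂, hM₂i, hM₂⟩ := exists_isotropic_not_isGroupLikeObj hF₂ hN₂
  -- hulls and the induced arrow `φ'` between them
  obtain ⟨A', hA, hhA⟩ := hF₁.vii_a A
  obtain ⟨B', hB, hhB⟩ := hF₁.vii_a B
  obtain ⟨hiA, hpA, hA'i, hunivA⟩ := id hhA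
  obtain ⟨hiB, hpB, hB'i, -⟩ := id hhB
  obtain ⟨φ', hφ', -⟩ := hunivA (φ ≫ hB) hB'i
  -- hφ' : hA ≫ φ' = φ ≫ hB
  have hdφ' : PreFrobenioid.degFr F₁ φ' = PreFrobenioid.degFr F₁ φ := by
    have := congrArg (PreFrobenioid.degFr F₁) hφ'
    rw [PreFrobenioid.degFr_comp, PreFrobenioid.degFr_comp, show PreFrobenioid.degFr F₁ hA = 1 from hpA.1,
      show PreFrobenioid.degFr F₁ hB = 1 from hpB.1, one_mul, mul_one] at this
    exact this
  -- the isotropic core on `Ψ^istr`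
  let a : PreFrobenioid.Istr F₁ := ⟨A', hA'i⟩
  let b : PreFrobenioid.Istr F₁ := ⟨B', hB'i⟩
  let f : a ⟶ b := ObjectProperty.homMk φ'
  have hcore : PreFrobenioid.degFr (PreFrobenioid.istrFunctor F₂) (Ψi.functor.map f) =
      PreFrobenioid.degFr (PreFrobenioid.istrFunctor F₁) f :=
    degFr_map_of_isotropic (PreFrobenioid.isFrobenioid_istr hF₁) (PreFrobenioid.isFrobenioid_istr hF₂)
      (fun X => PreFrobenioid.isIsotropic_istr X) (fun X => PreFrobenioid.isIsotropic_istr X) hD₁ hD₂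
      hnd₁ hnd₂ Ψi (N₁ := ⟨M₁, hM₁i⟩) hM₁ (N₂ := ⟨M₂, hM₂i⟩) hM₂ f
  have hΨφ' : PreFrobenioid.degFr F₂ (Ψ.functor.map φ') = PreFrobenioid.degFr F₁ φ' := hcore
  -- transfer along the hulls
  have hΨhA := (isIsometry_isPreStep_map hF₁ hF₂ hq₁ hq₂ Ψ hiA hpA).2
  have hΨhB := (isIsometry_isPreStep_map hF₁ hF₂ hq₁ hq₂ Ψ hiB hpB).2
  have := congrArg (fun g => PreFrobenioid.degFr F₂ (Ψ.functor.map g)) hφ'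
  simp only [Functor.map_comp, PreFrobenioid.degFr_comp] at this
  rw [show PreFrobenioid.degFr F₂ (Ψ.functor.map hA) = 1 from hΨhA.1,
    show PreFrobenioid.degFr F₂ (Ψ.functor.map hB) = 1 from hΨhB.1, one_mul, mul_one, hΨφ', hdφ'] at this
  exact this.symm

/-- **Thm. 3.4 (iii): `Ψ` preserves linear morphisms** (quasi-isotropic type).
[cite: MochizukiFrdI2008, Thm. 3.4 (iii) p.64] -/
theorem isLinear_map_quasiIsotropic (hF₁ : PreFrobenioid.IsFrobenioid F₁) (hF₂ : PreFrobenioid.IsFrobenioid F₂)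
    (hq₁ : (PreFrobenioidData.ofFunctor Φ₁ F₁).IsOfQuasiIsotropicType)
    (hq₂ : (PreFrobenioidData.ofFunctor Φ₂ F₂).IsOfQuasiIsotropicType) (hD₁ : IsOfFSMType D₁)
    (hD₂ : IsOfFSMType D₂) (hnd₁ : IsNonDilatingOn Φ₁) (hnd₂ : IsNonDilatingOn Φ₂) (Ψ : C₁ ≌ C₂)
    {N₁ : C₁} (hN₁ : ¬ PreFrobenioid.IsGroupLikeObj F₁ N₁) {N₂ : C₂}
    (hN₂ : ¬ PreFrobenioid.IsGroupLikeObj F₂ N₂) {A B : C₁} {φ : A ⟶ B}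
    (hφ : PreFrobenioid.IsLinear F₁ φ) : PreFrobenioid.IsLinear F₂ (Ψ.functor.map φ) := by
  change PreFrobenioid.degFr F₂ (Ψ.functor.map φ) = 1
  rw [degFr_map hF₁ hF₂ hq₁ hq₂ hD₁ hD₂ hnd₁ hnd₂ Ψ hN₁ hN₂ φ]
  exact hφ

/-- **Thm. 3.4 (iii): `Ψ` preserves morphisms of Frobenius type** (quasi-isotropic type; Prop. 1.7
(iii): minimal-coadjoint to the linear morphisms, which `Ψ⁻¹` preserves).
[cite: MochizukiFrdI2008, Thm. 3.4 (iii) p.64] -/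
theorem isFrobeniusType_map_quasiIsotropic (hF₁ : PreFrobenioid.IsFrobenioid F₁)
    (hF₂ : PreFrobenioid.IsFrobenioid F₂) (hq₁ : (PreFrobenioidData.ofFunctor Φ₁ F₁).IsOfQuasiIsotropicType)
    (hq₂ : (PreFrobenioidData.ofFunctor Φ₂ F₂).IsOfQuasiIsotropicType) (hD₁ : IsOfFSMType D₁)
    (hD₂ : IsOfFSMType D₂) (hnd₁ : IsNonDilatingOn Φ₁) (hnd₂ : IsNonDilatingOn Φ₂) (Ψ : C₁ ≌ C₂)
    {N₁ : C₁} (hN₁ : ¬ PreFrobenioid.IsGroupLikeObj F₁ N₁) {N₂ : C₂}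
    (hN₂ : ¬ PreFrobenioid.IsGroupLikeObj F₂ N₂) {A B : C₁} {φ : A ⟶ B}
    (hφ : PreFrobenioid.IsFrobeniusType F₁ φ) : PreFrobenioid.IsFrobeniusType F₂ (Ψ.functor.map φ) := by
  rw [PreFrobenioid.isFrobeniusType_iff_isMinimalCoadjoint F₂ hF₂]
  refine ((PreFrobenioid.isFrobeniusType_iff_isMinimalCoadjoint F₁ hF₁ φ).1 hφ).map_equivalence Ψ
    (S₂ := PreFrobenioid.linearMorphisms F₂) (fun X Y β hβ => ?_) (fun X Y Y' β j hj hβ => ?_)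
  · exact isLinear_map_quasiIsotropic hF₂ hF₁ hq₂ hq₁ hD₂ hD₁ hnd₂ hnd₁ Ψ.symm hN₂ hN₁ hβ
  · haveI := hj
    exact PreFrobenioid.IsLinear.comp F₁ hβ (PreFrobenioid.isLinear_of_isIso F₁ j)

/-- **Thm. 3.4 (iii): `Ψ` preserves base-isomorphisms** (quasi-isotropic type; Prop. 1.7 (ii)).
[cite: MochizukiFrdI2008, Thm. 3.4 (iii) p.64] -/
theorem isBaseIso_map_quasiIsotropic (hF₁ : PreFrobenioid.IsFrobenioid F₁)
    (hF₂ : PreFrobenioid.IsFrobenioid F₂) (hq₁ : (PreFrobenioidData.ofFunctor Φ₁ F₁).IsOfQuasiIsotropicType)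
    (hq₂ : (PreFrobenioidData.ofFunctor Φ₂ F₂).IsOfQuasiIsotropicType) (hD₁ : IsOfFSMType D₁)
    (hD₂ : IsOfFSMType D₂) (hnd₁ : IsNonDilatingOn Φ₁) (hnd₂ : IsNonDilatingOn Φ₂) (Ψ : C₁ ≌ C₂)
    {N₁ : C₁} (hN₁ : ¬ PreFrobenioid.IsGroupLikeObj F₁ N₁) {N₂ : C₂}
    (hN₂ : ¬ PreFrobenioid.IsGroupLikeObj F₂ N₂) {A B : C₁} {φ : A ⟶ B}
    (hφ : PreFrobenioid.IsBaseIso F₁ φ) : PreFrobenioid.IsBaseIso F₂ (Ψ.functor.map φ) := by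
  obtain ⟨X, β, α, hfac, hβ, hα⟩ :=
    (PreFrobenioid.isBaseIso_iff_exists_frobeniusType_preStep F₁ hF₁ φ).1 hφ
  rw [← hfac, Functor.map_comp]
  exact PreFrobenioid.IsBaseIso.comp F₂
    (isFrobeniusType_map_quasiIsotropic hF₁ hF₂ hq₁ hq₂ hD₁ hD₂ hnd₁ hnd₂ Ψ hN₁ hN₂ hβ).2
    (isPreStep_map_of_quasiIsotropic_of_isOfFSMType hF₁ hF₂ hq₁ hq₂ hD₂ Ψ hα).2

/-- **Thm. 3.4 (iii): `Ψ` preserves pull-back morphisms** (quasi-isotropic type; Prop. 1.7 (ii):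
minimal-adjoint to the base-isomorphisms, which `Ψ⁻¹` preserves). [cite: MochizukiFrdI2008, Thm. 3.4 (iii) p.64] -/
theorem isPullbackMorphism_map_quasiIsotropic (hF₁ : PreFrobenioid.IsFrobenioid F₁)
    (hF₂ : PreFrobenioid.IsFrobenioid F₂) (hq₁ : (PreFrobenioidData.ofFunctor Φ₁ F₁).IsOfQuasiIsotropicType)
    (hq₂ : (PreFrobenioidData.ofFunctor Φ₂ F₂).IsOfQuasiIsotropicType) (hD₁ : IsOfFSMType D₁)
    (hD₂ : IsOfFSMType D₂) (hnd₁ : IsNonDilatingOn Φ₁) (hnd₂ : IsNonDilatingOn Φ₂) (Ψ : C₁ ≌ C₂)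
    {N₁ : C₁} (hN₁ : ¬ PreFrobenioid.IsGroupLikeObj F₁ N₁) {N₂ : C₂}
    (hN₂ : ¬ PreFrobenioid.IsGroupLikeObj F₂ N₂) {A B : C₁} {φ : A ⟶ B}
    (hφ : PreFrobenioid.IsPullbackMorphism F₁ φ) : PreFrobenioid.IsPullbackMorphism F₂ (Ψ.functor.map φ) := by
  rw [PreFrobenioid.isPullbackMorphism_iff_isMinimalAdjoint F₂ hF₂]
  refine ((PreFrobenioid.isPullbackMorphism_iff_isMinimalAdjoint F₁ hF₁ φ).1 hφ).map_equivalence Ψ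
    (S₂ := PreFrobenioid.baseIsomorphisms F₂) (fun X Y β hβ => ?_) (fun X X' Y i β hi hβ => ?_)
  · exact isBaseIso_map_quasiIsotropic hF₂ hF₁ hq₂ hq₁ hD₂ hD₁ hnd₂ hnd₁ Ψ.symm hN₂ hN₁ hβ
  · haveI := hi
    exact PreFrobenioid.IsBaseIso.comp F₁ (PreFrobenioid.isBaseIso_of_isIso F₁ i) hβ

/-- **Thm. 3.4 (iii): `Ψ` preserves isometries** (quasi-isotropic type; Def. 1.3 (iv)(a) factorisation:
its three parts are a morphism of Frobenius type, an isometric pre-step (Thm. 3.4 (i)) and a pull-back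
morphism). [cite: MochizukiFrdI2008, Thm. 3.4 (iii) p.64] -/
theorem isIsometry_map_quasiIsotropic (hF₁ : PreFrobenioid.IsFrobenioid F₁)
    (hF₂ : PreFrobenioid.IsFrobenioid F₂) (hq₁ : (PreFrobenioidData.ofFunctor Φ₁ F₁).IsOfQuasiIsotropicType)
    (hq₂ : (PreFrobenioidData.ofFunctor Φ₂ F₂).IsOfQuasiIsotropicType) (hD₁ : IsOfFSMType D₁)
    (hD₂ : IsOfFSMType D₂) (hnd₁ : IsNonDilatingOn Φ₁) (hnd₂ : IsNonDilatingOn Φ₂) (Ψ : C₁ ≌ C₂)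
    {N₁ : C₁} (hN₁ : ¬ PreFrobenioid.IsGroupLikeObj F₁ N₁) {N₂ : C₂}
    (hN₂ : ¬ PreFrobenioid.IsGroupLikeObj F₂ N₂) {A B : C₁} {φ : A ⟶ B}
    (hφ : PreFrobenioid.IsIsometry F₁ φ) : PreFrobenioid.IsIsometry F₂ (Ψ.functor.map φ) := by
  have hP₁ := hF₁.isPreFrobenioid
  obtain ⟨X, Y, γ, β, α, hfac, hγ, hβ, hα⟩ := hF₁.iv_a_exists φ
  have h : PreFrobenioid.IsIsometry F₁ (γ ≫ β ≫ α) := by rw [hfac]; exact hφ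
  have hβi : PreFrobenioid.IsIsometry F₁ β :=
    (PreFrobenioid.isIsometry_factors F₁ hP₁ (PreFrobenioid.isIsometry_factors F₁ hP₁ h).1).2
  rw [← hfac, Functor.map_comp, Functor.map_comp]
  exact PreFrobenioid.IsIsometry.comp F₂
    (isFrobeniusType_map_quasiIsotropic hF₁ hF₂ hq₁ hq₂ hD₁ hD₂ hnd₁ hnd₂ Ψ hN₁ hN₂ hγ).1.2
    (PreFrobenioid.IsIsometry.comp F₂ (isIsometry_isPreStep_map hF₁ hF₂ hq₁ hq₂ Ψ hβi hβ).1
      (hF₂.iv_b _ (isPullbackMorphism_map_quasiIsotropic hF₁ hF₂ hq₁ hq₂ hD₁ hD₂ hnd₁ hnd₂ Ψ hN₁ hN₂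
        hα)).1.2)

/-- **Thm. 3.4 (iii): `Ψ` preserves co-angular morphisms** (quasi-isotropic type; Def. 1.2 (iii): the
test factorisations in `C₂` pull back along `Ψ⁻¹`, whose parts keep their type: linear, isometric
pre-step, base-isomorphism). [cite: MochizukiFrdI2008, Thm. 3.4 (iii) p.64] -/
theorem isCoAngular_map_quasiIsotropic (hF₁ : PreFrobenioid.IsFrobenioid F₁)
    (hF₂ : PreFrobenioid.IsFrobenioid F₂) (hq₁ : (PreFrobenioidData.ofFunctor Φ₁ F₁).IsOfQuasiIsotropicType)
    (hq₂ : (PreFrobenioidData.ofFunctor Φ₂ F₂).IsOfQuasiIsotropicType) (hD₁ : IsOfFSMType D₁)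
    (hD₂ : IsOfFSMType D₂) (hnd₁ : IsNonDilatingOn Φ₁) (hnd₂ : IsNonDilatingOn Φ₂) (Ψ : C₁ ≌ C₂)
    {N₁ : C₁} (hN₁ : ¬ PreFrobenioid.IsGroupLikeObj F₁ N₁) {N₂ : C₂}
    (hN₂ : ¬ PreFrobenioid.IsGroupLikeObj F₂ N₂) {A B : C₁} {φ : A ⟶ B}
    (hφ : PreFrobenioid.IsCoAngular F₁ φ) : PreFrobenioid.IsCoAngular F₂ (Ψ.functor.map φ) := by
  have hP₁ := hF₁.isPreFrobenioid
  intro X' Y' γ' β' α' hfac hα' hβ'i hβ'p hbi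
  -- pull the factorisation back to `C₁`
  have key : Ψ.unit.app A ≫ Ψ.inverse.map γ' ≫ Ψ.inverse.map β' ≫ Ψ.inverse.map α' ≫ Ψ.unitInv.app B = φ := by
    rw [← Ψ.inverse.map_comp_assoc, ← Ψ.inverse.map_comp_assoc, Category.assoc, hfac, Ψ.inv_fun_map]
    simp
  have hfac₁ : (Ψ.unit.app A ≫ Ψ.inverse.map γ') ≫ Ψ.inverse.map β' ≫
      (Ψ.inverse.map α' ≫ Ψ.unitInv.app B) = φ := by
    simpa only [Category.assoc] using key
  have hα₁ : PreFrobenioid.IsLinear F₁ (Ψ.inverse.map α' ≫ Ψ.unitInv.app B) :=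
    PreFrobenioid.IsLinear.comp F₁
      (isLinear_map_quasiIsotropic hF₂ hF₁ hq₂ hq₁ hD₂ hD₁ hnd₂ hnd₁ Ψ.symm hN₂ hN₁ hα')
      (PreFrobenioid.isLinear_of_isIso F₁ _)
  obtain ⟨hβ₁i, hβ₁p⟩ := isIsometry_isPreStep_map hF₂ hF₁ hq₂ hq₁ Ψ.symm hβ'i hβ'p
  have hbi₁ : PreFrobenioid.IsBaseIso F₁ (Ψ.inverse.map α' ≫ Ψ.unitInv.app B) ∨
      PreFrobenioid.IsBaseIso F₁ (Ψ.unit.app A ≫ Ψ.inverse.map γ') := by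
    rcases hbi with h | h
    · exact Or.inl (PreFrobenioid.IsBaseIso.comp F₁
        (isBaseIso_map_quasiIsotropic hF₂ hF₁ hq₂ hq₁ hD₂ hD₁ hnd₂ hnd₁ Ψ.symm hN₂ hN₁ h)
        (PreFrobenioid.isBaseIso_of_isIso F₁ _))
    · exact Or.inr (PreFrobenioid.IsBaseIso.comp F₁ (PreFrobenioid.isBaseIso_of_isIso F₁ _)
        (isBaseIso_map_quasiIsotropic hF₂ hF₁ hq₂ hq₁ hD₂ hD₁ hnd₂ hnd₁ Ψ.symm hN₂ hN₁ h))
  haveI := hφ _ _ _ hfac₁ hα₁ hβ₁i hβ₁p hbi₁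
  exact isIso_of_fully_faithful Ψ.inverse β'

/-- **Thm. 3.4 (iii): `Ψ` preserves LB-invertible morphisms** (quasi-isotropic type).
[cite: MochizukiFrdI2008, Thm. 3.4 (iii) p.64] -/
theorem isLBInvertible_map_quasiIsotropic (hF₁ : PreFrobenioid.IsFrobenioid F₁)
    (hF₂ : PreFrobenioid.IsFrobenioid F₂) (hq₁ : (PreFrobenioidData.ofFunctor Φ₁ F₁).IsOfQuasiIsotropicType)
    (hq₂ : (PreFrobenioidData.ofFunctor Φ₂ F₂).IsOfQuasiIsotropicType) (hD₁ : IsOfFSMType D₁)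
    (hD₂ : IsOfFSMType D₂) (hnd₁ : IsNonDilatingOn Φ₁) (hnd₂ : IsNonDilatingOn Φ₂) (Ψ : C₁ ≌ C₂)
    {N₁ : C₁} (hN₁ : ¬ PreFrobenioid.IsGroupLikeObj F₁ N₁) {N₂ : C₂}
    (hN₂ : ¬ PreFrobenioid.IsGroupLikeObj F₂ N₂) {A B : C₁} {φ : A ⟶ B}
    (hφ : PreFrobenioid.IsLBInvertible F₁ φ) : PreFrobenioid.IsLBInvertible F₂ (Ψ.functor.map φ) :=
  ⟨isCoAngular_map_quasiIsotropic hF₁ hF₂ hq₁ hq₂ hD₁ hD₂ hnd₁ hnd₂ Ψ hN₁ hN₂ hφ.1,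
    isIsometry_map_quasiIsotropic hF₁ hF₂ hq₁ hq₂ hD₁ hD₂ hnd₁ hnd₂ Ψ hN₁ hN₂ hφ.2⟩

/-! ### Packaging in the vocabulary of the §3 statement files (`PreFrobenioidData.ofFunctor`) -/

/-- Adapter: the statement files' "`Φ` non-dilating" (Def. 1.1 (ii)) implies found's `IsNonDilatingOn Φ`
(the two renderings differ by `∀ a, α a = a` versus `α = id`). [cite: MochizukiFrdI2008, Def. 1.1 (ii) p.19] -/
theorem isNonDilatingOn_of_ofFunctor {D : Type u} [Category.{v} D] {Φ : Dᵒᵖ ⥤ CommMonCat.{w}}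
    {C : Type u'} [Category.{v'} C] {F : C ⥤ ElemFrobenioid Φ}
    (h : (PreFrobenioidData.ofFunctor Φ F).IsNonDilatingOn) : IsNonDilatingOn Φ :=
  fun X f hle => MonoidHom.ext (h.nonDilating X f hle)

/-- **Thm. 3.4 (iii), morphism part, in the shape of the typed statement `PreFrobenioidData.Thm34iii`**
— the cell's repaired variant: for Frobenioids of quasi-isotropic type over bases of FSM-type with
non-dilating divisor monoids and non-group-like objects on both sides (standard type (a), (e); not of
group-like type; "FSMFF" strengthened to "FSM"), `Ψ` preserves morphisms of Frobenius type, linear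
morphisms, base-isomorphisms, co-angular morphisms, pull-back morphisms, isometries and LB-invertible
morphisms, and `Ψ^{ℕ≥1}` is the identity. [cite: MochizukiFrdI2008, Thm. 3.4 (iii) p.62] -/
theorem thm34iii_morphisms_of_isOfFSMType (hF₁ : PreFrobenioid.IsFrobenioid F₁)
    (hF₂ : PreFrobenioid.IsFrobenioid F₂) (hq₁ : (PreFrobenioidData.ofFunctor Φ₁ F₁).IsOfQuasiIsotropicType)
    (hq₂ : (PreFrobenioidData.ofFunctor Φ₂ F₂).IsOfQuasiIsotropicType) (hD₁ : IsOfFSMType D₁)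
    (hD₂ : IsOfFSMType D₂) (hnd₁ : (PreFrobenioidData.ofFunctor Φ₁ F₁).IsNonDilatingOn)
    (hnd₂ : (PreFrobenioidData.ofFunctor Φ₂ F₂).IsNonDilatingOn) (Ψ : C₁ ≌ C₂)
    (hN₁ : ∃ A : C₁, ¬ (PreFrobenioidData.ofFunctor Φ₁ F₁).IsGroupLikeObj A)
    (hN₂ : ∃ A : C₂, ¬ (PreFrobenioidData.ofFunctor Φ₂ F₂).IsGroupLikeObj A) :
    (PreFrobenioidData.PreservesMor Ψ.functor (PreFrobenioidData.ofFunctor Φ₁ F₁).IsFrobeniusType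
        (PreFrobenioidData.ofFunctor Φ₂ F₂).IsFrobeniusType ∧
      PreFrobenioidData.PreservesMor Ψ.functor (PreFrobenioidData.ofFunctor Φ₁ F₁).IsLinear
        (PreFrobenioidData.ofFunctor Φ₂ F₂).IsLinear ∧
      PreFrobenioidData.PreservesMor Ψ.functor (PreFrobenioidData.ofFunctor Φ₁ F₁).IsBaseIso
        (PreFrobenioidData.ofFunctor Φ₂ F₂).IsBaseIso ∧
      PreFrobenioidData.PreservesMor Ψ.functor (PreFrobenioidData.ofFunctor Φ₁ F₁).IsCoAngular
        (PreFrobenioidData.ofFunctor Φ₂ F₂).IsCoAngular ∧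
      PreFrobenioidData.PreservesMor Ψ.functor (PreFrobenioidData.ofFunctor Φ₁ F₁).IsPullbackMorphism
        (PreFrobenioidData.ofFunctor Φ₂ F₂).IsPullbackMorphism ∧
      PreFrobenioidData.PreservesMor Ψ.functor (PreFrobenioidData.ofFunctor Φ₁ F₁).IsIsometry
        (PreFrobenioidData.ofFunctor Φ₂ F₂).IsIsometry ∧
      PreFrobenioidData.PreservesMor Ψ.functor (PreFrobenioidData.ofFunctor Φ₁ F₁).IsLBInvertible
        (PreFrobenioidData.ofFunctor Φ₂ F₂).IsLBInvertible) ∧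
    ∃ ΨN : ℕ+ ≃* ℕ+, (∀ ⦃A B : C₁⦄ (φ : A ⟶ B),
        (PreFrobenioidData.ofFunctor Φ₂ F₂).degFr (Ψ.functor.map φ) =
          ΨN ((PreFrobenioidData.ofFunctor Φ₁ F₁).degFr φ)) ∧ ΨN = MulEquiv.refl ℕ+ := by
  obtain ⟨N₁, hN₁⟩ := hN₁
  obtain ⟨N₂, hN₂⟩ := hN₂
  rw [PreFrobenioidData.ofFunctor_isGroupLikeObj] at hN₁ hN₂
  have hn₁ := isNonDilatingOn_of_ofFunctor hnd₁
  have hn₂ := isNonDilatingOn_of_ofFunctor hnd₂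
  refine ⟨⟨fun A B φ hφ => ?_, fun A B φ hφ => ?_, fun A B φ hφ => ?_, fun A B φ hφ => ?_,
    fun A B φ hφ => ?_, fun A B φ hφ => ?_, fun A B φ hφ => ?_⟩, MulEquiv.refl ℕ+, fun A B φ => ?_, rfl⟩
  · rw [PreFrobenioidData.ofFunctor_isFrobeniusType] at hφ ⊢
    exact isFrobeniusType_map_quasiIsotropic hF₁ hF₂ hq₁ hq₂ hD₁ hD₂ hn₁ hn₂ Ψ hN₁ hN₂ hφ
  · exact isLinear_map_quasiIsotropic hF₁ hF₂ hq₁ hq₂ hD₁ hD₂ hn₁ hn₂ Ψ hN₁ hN₂ hφ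
  · exact isBaseIso_map_quasiIsotropic hF₁ hF₂ hq₁ hq₂ hD₁ hD₂ hn₁ hn₂ Ψ hN₁ hN₂ hφ
  · rw [PreFrobenioidData.ofFunctor_isCoAngular] at hφ ⊢
    exact isCoAngular_map_quasiIsotropic hF₁ hF₂ hq₁ hq₂ hD₁ hD₂ hn₁ hn₂ Ψ hN₁ hN₂ hφ
  · rw [PreFrobenioidData.ofFunctor_isPullbackMorphism] at hφ ⊢
    exact isPullbackMorphism_map_quasiIsotropic hF₁ hF₂ hq₁ hq₂ hD₁ hD₂ hn₁ hn₂ Ψ hN₁ hN₂ hφ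
  · exact isIsometry_map_quasiIsotropic hF₁ hF₂ hq₁ hq₂ hD₁ hD₂ hn₁ hn₂ Ψ hN₁ hN₂ hφ
  · rw [PreFrobenioidData.ofFunctor_isLBInvertible] at hφ ⊢
    exact isLBInvertible_map_quasiIsotropic hF₁ hF₂ hq₁ hq₂ hD₁ hD₂ hn₁ hn₂ Ψ hN₁ hN₂ hφ
  · exact degFr_map hF₁ hF₂ hq₁ hq₂ hD₁ hD₂ hn₁ hn₂ Ψ hN₁ hN₂ φ

end Two

end FrdI

end Literature.AlgebraicGeometry.Frobenioids
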